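import Summits.HodgeConjecture.HodgeConjecture.Theorems.CyclicUnitaryPowersBlockAction

/-!
# Pattern words: the word model of the coloured GL first fundamental theorem for the deck-unitary group

Helper for stub L `stub_deckUnitaryInvariantsMatching` of the crux `PowersHodgeOfDeckCommutators`
(stmt-HodgeConjecture-19545, route `CyclicUnitaryPowers`, line `unitary-kunneth-fft` v6, lane 2); sequel of
`CyclicUnitaryPowersBlockAction` (tensor coordinates `tcoord f x w` in a basis `f` indexed by the letters
`Option (Fin h × Bool × Fin n)`, and the block elements of `U⁰(K)`).

* §3 PATTERN COORDINATES: for a block pattern `κ : Fin r → Option (Fin h × Bool)` of the positions and an enumeration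
  `e : Fin d ≃ {q // (κ q).isSome}` of the positions off `E_0`, the words `embWord κ e ν` of pattern `κ` with block
  coordinates `ν : Fin d → Fin n` and the coefficient tensor `patternCoord f κ e x : (Fin d → Fin n) → K`; a linear
  automorphism `γ` with the matrix of a single-colour BLOCK ELEMENT (`IsBlockElem f i g γ`: `g` on the vector letters of
  colour `i`, `(g⁻¹)ᵀ` on its covector letters, identity elsewhere) acts on the pattern coordinates by the coloured
  Kronecker product `mixedFamily col ty (update 1 i g)` of `ClassicalInvariants/TensorFFTGeneralLinear`
  (`patternCoord_act`), so if it fixes `x` the Kronecker product fixes `patternCoord f κ e x`;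
* §4 invariance under every single-colour Kronecker product implies invariance under all `mixedFamily col ty g`,
  `g : Fin h → GL_n(K)` — the hypothesis of Goodman–Wallach Thm. 5.3.1 coloured
  (`mem_span_contractionTensor_of_forall_wordRepAt_mixedFamily_eq`).

Pure linear algebra; no Hodge theory.
-/

noncomputable section

open Module Matrix
open scoped TensorProduct PiTensorProduct BigOperators

namespace Summit.HodgeConjecture.HodgeConjecture.Theorems.CyclicUnitaryPowersPatternWords

open Literature.AlgebraicGeometry.Motives
open Literature.RepresentationTheory.GeneralLinear (wordRepAt wordRepAt_apply wordRepAt_mul wordRepAt_one)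
open Literature.RepresentationTheory.ClassicalInvariants (mixedFamily mixedFamily_of_eq_true mixedFamily_of_eq_false)
open Summit.HodgeConjecture.HodgeConjecture.Theorems.CyclicUnitaryPowersBlockAction

variable {K : Type*} [Field K] {W : Type*} [AddCommGroup W] [Module K W]

/-! ### §3 Pattern coordinates and the coloured Kronecker products -/

section Pattern

variable {h n : ℕ} (f : Basis (Option (Fin h × Bool × Fin n)) K W) {r : ℕ}

/-- The block shape of a letter (colour and kind), `none` for the letter `x₀`. [folklore] -/
def shape (l : Option (Fin h × Bool × Fin n)) : Option (Fin h × Bool) := l.map fun x => (x.1, x.2.1)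

/-- `shape none = none`. [folklore] -/
@[simp] theorem shape_none : shape (none : Option (Fin h × Bool × Fin n)) = none := rfl
/-- `shape (some (i, b, a)) = some (i, b)`. [folklore] -/
@[simp] theorem shape_some (i : Fin h) (b : Bool) (a : Fin n) : shape (some (i, b, a)) = some (i, b) := rfl

variable (κ : Fin r → Option (Fin h × Bool)) {d : ℕ} (e : Fin d ≃ {q : Fin r // (κ q).isSome})

/-- The word of block pattern `κ` with block coordinates `ν` on the positions off `E_0` (enumerated by `e`).
[folklore] -/
def embWord (ν : Fin d → Fin n) : Fin r → Option (Fin h × Bool × Fin n) := fun q =>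
  if hq : (κ q).isSome then some (((κ q).get hq).1, ((κ q).get hq).2, ν (e.symm ⟨q, hq⟩)) else none

/-- The embedded word has pattern `κ`. [folklore] -/
theorem shape_embWord (ν : Fin d → Fin n) (q : Fin r) : shape (embWord κ e ν q) = κ q := by
  unfold embWord
  split_ifs with hq
  · rw [shape_some]
    conv_rhs => rw [← Option.some_get hq]
  · rw [shape_none]
    exact (Option.not_isSome_iff_eq_none.mp hq).symm

/-- The embedded word at a position off `E_0`. [folklore] -/
theorem embWord_apply_coe (ν : Fin d → Fin n) (k : Fin d) :
    embWord κ e ν (e k) = some (((κ (e k)).get (e k).2).1, ((κ (e k)).get (e k).2).2, ν k) := by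
  unfold embWord
  rw [dif_pos (e k).2]
  congr
  exact e.symm_apply_apply k

/-- The embedded word at a position on `E_0`. [folklore] -/
theorem embWord_apply_of_not (ν : Fin d → Fin n) {q : Fin r} (hq : ¬ (κ q).isSome) : embWord κ e ν q = none := by
  unfold embWord
  rw [dif_neg hq]

/-- `embWord` is injective. [folklore] -/
theorem embWord_injective : Function.Injective (embWord (n := n) κ e) := by
  intro ν ν' hνν'
  funext k
  have h := congrFun hνν' (e k)
  rw [embWord_apply_coe, embWord_apply_coe] at h
  simpa using h

/-- A letter whose shape is `isSome` is `isSome`. [folklore] -/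
theorem isSome_of_shape {l : Option (Fin h × Bool × Fin n)} {o : Option (Fin h × Bool)} (hl : shape l = o)
    (ho : o.isSome) : l.isSome := by
  rcases l with _ | x
  · rw [shape_none] at hl; rw [← hl] at ho; exact absurd ho (by simp)
  · rfl

/-- The block coordinates of a word of pattern `κ`. [folklore] -/
def wordCoord (w : Fin r → Option (Fin h × Bool × Fin n)) (hw : ∀ q, shape (w q) = κ q) : Fin d → Fin n :=
  fun k => ((w (e k)).get (isSome_of_shape (hw (e k)) (e k).2)).2.2

/-- A word of pattern `κ` is the embedded word of its block coordinates. [folklore] -/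
theorem embWord_wordCoord {w : Fin r → Option (Fin h × Bool × Fin n)} (hw : ∀ q, shape (w q) = κ q) :
    embWord κ e (wordCoord κ e w hw) = w := by
  funext q
  by_cases hq : (κ q).isSome
  · obtain ⟨k, rfl⟩ : ∃ k, (e k : Fin r) = q := ⟨e.symm ⟨q, hq⟩, by rw [Equiv.apply_symm_apply]⟩
    rw [embWord_apply_coe]
    have hy : (w (e k)).isSome := isSome_of_shape (hw (e k)) (e k).2
    have hwy : w (e k) = some ((w (e k)).get hy) := (Option.some_get hy).symm
    have hκ : κ (e k) = some (((w (e k)).get hy).1, ((w (e k)).get hy).2.1) := by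
      rw [← hw (e k)]
      conv_lhs => rw [hwy]
      rfl
    obtain ⟨h', hget⟩ := Option.eq_some_iff_get_eq.mp hκ
    have hget' : (κ (e k)).get (e k).2 = (((w (e k)).get hy).1, ((w (e k)).get hy).2.1) := hget
    rw [hget']
    conv_rhs => rw [hwy]
    rfl
  · rw [embWord_apply_of_not κ e _ hq]
    have h := hw q
    rw [Option.not_isSome_iff_eq_none.mp hq] at h
    rcases hwq : w q with _ | x
    · rfl
    · rw [hwq, shape_some] at h; exact absurd h (Option.some_ne_none _)

/-- A word of pattern `κ` is an embedded word. [folklore] -/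
theorem exists_embWord_of_shape {w : Fin r → Option (Fin h × Bool × Fin n)} (hw : ∀ q, shape (w q) = κ q) :
    ∃ ν, embWord κ e ν = w :=
  ⟨wordCoord κ e w hw, embWord_wordCoord κ e hw⟩

/-- The colour of the `k`-th position off `E_0`. [folklore] -/
def patCol (k : Fin d) : Fin h := ((κ (e k)).get (e k).2).1

/-- The type (vector = `true`) of the `k`-th position off `E_0`. [folklore] -/
def patTy (k : Fin d) : Bool := !((κ (e k)).get (e k).2).2

/-- **The pattern coordinates** of `x`: its coefficients along the tensor basis vectors of pattern `κ`, as a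
function of the block coordinates. [folklore] -/
def patternCoord (x : hodgeTensorSpaceOver K W r 0) (ν : Fin d → Fin n) : K := tcoord f x (embWord κ e ν)

variable {f κ e}

/-- The matrix hypotheses of a single-colour block element `γ` (colour `i`, matrix `g`): `g` on the vector letters
of colour `i`, `(g⁻¹)ᵀ` on the covector letters of colour `i`, identity on all other letters. [folklore] -/
structure IsBlockElem (f : Basis (Option (Fin h × Bool × Fin n)) K W) (i : Fin h) (g : GL (Fin n) K)
    (γ : W ≃ₗ[K] W) : Prop where
  /-- action on vector letters of colour `i` -/
  vec : ∀ a, γ (f (some (i, false, a))) = ∑ a', (g : Matrix (Fin n) (Fin n) K) a' a • f (some (i, false, a'))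
  /-- action on covector letters of colour `i` -/
  cov : ∀ a, γ (f (some (i, true, a))) =
    ∑ a', ((g⁻¹ : GL (Fin n) K) : Matrix (Fin n) (Fin n) K) a a' • f (some (i, true, a'))
  /-- fixes `x₀` -/
  none : γ (f none) = f none
  /-- fixes the letters of the other colours -/
  other : ∀ i', i' ≠ i → ∀ b a, γ (f (some (i', b, a))) = f (some (i', b, a))

/-- Coordinates of a combination of the letters `some (i, b, ·)` at a letter `some (i₂, b₂, a₂)`. [folklore] -/
theorem repr_sum_smul_letter_some (i : Fin h) (b : Bool) (c : Fin n → K) (i₂ : Fin h) (b₂ : Bool) (a₂ : Fin n) :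
    f.repr (∑ a', c a' • f (some (i, b, a'))) (some (i₂, b₂, a₂)) = if i₂ = i ∧ b₂ = b then c a₂ else 0 := by
  simp only [map_sum, map_smul, Basis.repr_self, Finsupp.coe_finsetSum, Finsupp.coe_smul, Finset.sum_apply,
    Pi.smul_apply, Finsupp.single_apply, smul_eq_mul, mul_ite, mul_one, mul_zero]
  by_cases hib : i₂ = i ∧ b₂ = b
  · obtain ⟨rfl, rfl⟩ := hib
    rw [if_pos ⟨rfl, rfl⟩, Finset.sum_eq_single a₂]
    · simp
    · intro a' _ ha'; rw [if_neg]; simpa using ha'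
    · intro hh; exact absurd (Finset.mem_univ _) hh
  · rw [if_neg hib]
    refine Finset.sum_eq_zero fun a' _ => ?_
    rw [if_neg]
    intro hh
    apply hib
    simp only [Option.some.injEq, Prod.mk.injEq] at hh
    exact ⟨hh.1.symm, hh.2.1.symm⟩

/-- Coordinates of a combination of the letters `some (i, b, ·)` at the letter `none` vanish. [folklore] -/
theorem repr_sum_smul_letter_none (i : Fin h) (b : Bool) (c : Fin n → K) :
    f.repr (∑ a', c a' • f (some (i, b, a'))) none = 0 := by
  simp only [map_sum, map_smul, Basis.repr_self, Finsupp.coe_finsetSum, Finsupp.coe_smul, Finset.sum_apply,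
    Pi.smul_apply, Finsupp.single_apply, smul_eq_mul]
  exact Finset.sum_eq_zero fun a' _ => by rw [if_neg (Option.some_ne_none _), mul_zero]

variable {i : Fin h} {g : GL (Fin n) K} {γ : W ≃ₗ[K] W}

/-- **Matrix entries of a block element vanish across different shapes.** [folklore] -/
theorem toMatrix_eq_zero_of_shape_ne (hγ : IsBlockElem f i g γ) {l l' : Option (Fin h × Bool × Fin n)}
    (hll' : shape l' ≠ shape l) : LinearMap.toMatrix f f (γ : W →ₗ[K] W) l' l = 0 := by
  rw [LinearMap.toMatrix_apply, LinearEquiv.coe_coe]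
  rcases l with _ | ⟨i₁, b₁, a₁⟩
  · rw [hγ.none, Basis.repr_self, Finsupp.single_apply, if_neg]
    rintro rfl; exact hll' rfl
  · by_cases hi : i₁ = i
    · subst hi
      have key : ∀ (c : Fin n → K), f.repr (∑ a', c a' • f (some (i₁, b₁, a'))) l' = 0 := by
        intro c
        rcases l' with _ | ⟨i₂, b₂, a₂⟩
        · exact repr_sum_smul_letter_none i₁ b₁ c
        · rw [repr_sum_smul_letter_some, if_neg]
          rintro ⟨rfl, rfl⟩
          exact hll' rfl
      cases b₁
      · rw [hγ.vec]; exact key _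
      · rw [hγ.cov]; exact key _
    · rw [hγ.other i₁ hi, Basis.repr_self, Finsupp.single_apply, if_neg]
      rintro rfl; exact hll' rfl

/-- **Matrix entries of a block element between letters of the same shape** are those of the coloured Kronecker
factor: `g` (vector letters of colour `i`), `(g⁻¹)ᵀ` (covector letters of colour `i`), identity otherwise. [folklore] -/
theorem toMatrix_some_some (hγ : IsBlockElem f i g γ) (i₁ : Fin h) (b₁ : Bool) (a a' : Fin n) :
    LinearMap.toMatrix f f (γ : W →ₗ[K] W) (some (i₁, b₁, a')) (some (i₁, b₁, a)) =
      mixedFamily K (fun _ : Fin 1 => i₁) (fun _ => !b₁) (Function.update 1 i g) 0 a' a := by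
  rw [LinearMap.toMatrix_apply, LinearEquiv.coe_coe]
  by_cases hi : i₁ = i
  · subst hi
    cases b₁
    · rw [hγ.vec, repr_sum_smul_letter_some, if_pos ⟨rfl, rfl⟩, mixedFamily_of_eq_true _ _ (by rfl),
        Function.update_self]
    · rw [hγ.cov, repr_sum_smul_letter_some, if_pos ⟨rfl, rfl⟩, mixedFamily_of_eq_false _ _ (by rfl),
        Function.update_self, Matrix.transpose_apply]
  · rw [hγ.other i₁ hi, Basis.repr_self, Finsupp.single_apply]
    cases b₁
    · rw [mixedFamily_of_eq_true _ _ (by rfl), Function.update_of_ne hi, Pi.one_apply, Units.val_one,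
        Matrix.one_apply]
      simp only [Option.some.injEq, Prod.mk.injEq, true_and, eq_comm]
    · rw [mixedFamily_of_eq_false _ _ (by rfl), Function.update_of_ne hi, Pi.one_apply, inv_one, Units.val_one,
        Matrix.transpose_one, Matrix.one_apply]
      simp only [Option.some.injEq, Prod.mk.injEq, true_and, eq_comm]

/-- Matrix entry `none`/`none` of a block element is `1`. [folklore] -/
theorem toMatrix_none_none (hγ : IsBlockElem f i g γ) : LinearMap.toMatrix f f (γ : W →ₗ[K] W) none none = 1 := by
  rw [LinearMap.toMatrix_apply, LinearEquiv.coe_coe, hγ.none, Basis.repr_self, Finsupp.single_eq_same]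

/-- **The Kronecker coefficient between two words of pattern `κ`** is the coloured Kronecker coefficient of the block
coordinates. [folklore] -/
theorem prod_toMatrix_embWord (hγ : IsBlockElem f i g γ) (ν ν' : Fin d → Fin n) :
    ∏ q, LinearMap.toMatrix f f (γ : W →ₗ[K] W) (embWord κ e ν' q) (embWord κ e ν q) =
      ∏ k, mixedFamily K (patCol κ e) (patTy κ e) (Function.update 1 i g) k (ν' k) (ν k) := by
  rw [← Fintype.prod_subtype_mul_prod_subtype (fun q : Fin r => (κ q).isSome)]
  have h2 : ∏ q : {q : Fin r // ¬ (κ q).isSome},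
      LinearMap.toMatrix f f (γ : W →ₗ[K] W) (embWord κ e ν' q) (embWord κ e ν q) = 1 :=
    Finset.prod_eq_one fun q _ => by rw [embWord_apply_of_not κ e _ q.2, embWord_apply_of_not κ e _ q.2, toMatrix_none_none hγ]
  rw [h2, mul_one, ← e.prod_comp]
  refine Fintype.prod_congr _ _ fun k => ?_
  rw [embWord_apply_coe, embWord_apply_coe, toMatrix_some_some hγ]
  rfl

/-- **The action of a block element in pattern coordinates is the coloured Kronecker product.** [folklore] -/
theorem patternCoord_act (hγ : IsBlockElem f i g γ) (x : hodgeTensorSpaceOver K W r 0) (ν' : Fin d → Fin n) :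
    patternCoord f κ e (tensorSpaceActOver γ x) ν' =
      ∑ ν, (∏ k, mixedFamily K (patCol κ e) (patTy κ e) (Function.update 1 i g) k (ν' k) (ν k)) *
        patternCoord f κ e x ν := by
  classical
  unfold patternCoord
  rw [tcoord_tensorSpaceActOver]
  have hzero : ∀ w, w ∉ Set.range (embWord (n := n) κ e) →
      (∏ q, LinearMap.toMatrix f f (γ : W →ₗ[K] W) (embWord κ e ν' q) (w q)) * tcoord f x w = 0 := by
    intro w hw
    have hq : ∃ q, shape (w q) ≠ κ q := by
      by_contra hall
      push Not at hall
      exact hw (exists_embWord_of_shape κ e hall)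
    obtain ⟨q, hq⟩ := hq
    rw [Finset.prod_eq_zero (Finset.mem_univ q)
      (toMatrix_eq_zero_of_shape_ne hγ (by rw [shape_embWord]; exact fun h' => hq h'.symm)), zero_mul]
  refine (Literature.RepresentationTheory.ClassicalInvariants.sum_eq_sum_comp_of_injective (embWord (n := n) κ e)
    (embWord_injective κ e) (fun w => (∏ q, LinearMap.toMatrix f f (γ : W →ₗ[K] W) (embWord κ e ν' q) (w q)) *
      tcoord f x w) hzero).trans ?_
  exact Finset.sum_congr rfl fun ν _ => by simp only [prod_toMatrix_embWord hγ]

/-- **If a single-colour block element fixes `x`, its coloured Kronecker product fixes the pattern coordinates.**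
[folklore] -/
theorem wordRepAt_patternCoord_of_fixed (hγ : IsBlockElem f i g γ) {x : hodgeTensorSpaceOver K W r 0}
    (hx : tensorSpaceActOver γ x = x) :
    wordRepAt K (mixedFamily K (patCol κ e) (patTy κ e) (Function.update 1 i g)) (patternCoord f κ e x) =
      patternCoord f κ e x := by
  funext ν'
  rw [wordRepAt_apply, ← patternCoord_act hγ x ν', hx]

/-! ### §4 From single colours to all coloured Kronecker products -/

/-- The coloured Kronecker family is multiplicative in `g`. [folklore] -/
theorem mixedFamily_mul {ι : Type*} (col : Fin d → ι) (ty : Fin d → Bool) (g g' : ι → GL (Fin n) K) :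
    mixedFamily K col ty (g * g') = mixedFamily K col ty g * mixedFamily K col ty g' := by
  funext k
  rw [Pi.mul_apply]
  cases hk : ty k
  · rw [mixedFamily_of_eq_false _ _ hk, mixedFamily_of_eq_false _ _ hk, mixedFamily_of_eq_false _ _ hk, Pi.mul_apply,
      _root_.mul_inv_rev, Units.val_mul, Matrix.transpose_mul]
  · rw [mixedFamily_of_eq_true _ _ hk, mixedFamily_of_eq_true _ _ hk, mixedFamily_of_eq_true _ _ hk, Pi.mul_apply,
      Units.val_mul]

/-- **Invariance under every single-colour Kronecker product implies invariance under all coloured Kronecker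
products** (`Π_i GL_n` is generated by its factors). [folklore] -/
theorem wordRepAt_mixedFamily_eq_of_single (col : Fin d → Fin h) (ty : Fin d → Bool) (c : (Fin d → Fin n) → K)
    (hc : ∀ (i : Fin h) (g : GL (Fin n) K), wordRepAt K (mixedFamily K col ty (Function.update 1 i g)) c = c)
    (g : Fin h → GL (Fin n) K) : wordRepAt K (mixedFamily K col ty g) c = c := by
  classical
  -- restrict `g` to a finite set of colours and induct
  suffices hS : ∀ S : Finset (Fin h), wordRepAt K (mixedFamily K col ty (fun i => if i ∈ S then g i else 1)) c = c by
    have := hS Finset.univ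
    simpa only [Finset.mem_univ, if_true] using this
  intro S
  induction S using Finset.induction_on with
  | empty =>
    have h1 : mixedFamily K col ty (fun i : Fin h => if i ∈ (∅ : Finset (Fin h)) then g i else 1) = 1 := by
      funext k
      cases hk : ty k
      · rw [mixedFamily_of_eq_false _ _ hk]; simp
      · rw [mixedFamily_of_eq_true _ _ hk]; simp
    rw [h1, wordRepAt_one]
  | insert i S hi ih =>
    have hsplit : (fun i' : Fin h => if i' ∈ insert i S then g i' else 1) =
        Function.update (1 : Fin h → GL (Fin n) K) i (g i) * fun i' => if i' ∈ S then g i' else 1 := by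
      funext i'
      rw [Pi.mul_apply]
      by_cases h' : i' = i
      · subst h'; simp [hi]
      · rw [Function.update_of_ne h', Pi.one_apply, one_mul]
        simp [Finset.mem_insert, h']
    rw [hsplit, mixedFamily_mul, wordRepAt_mul, ih, hc]

end Pattern

end Summit.HodgeConjecture.HodgeConjecture.Theorems.CyclicUnitaryPowersPatternWords

end
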